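import Summits.QuantumFields.YangMills.Theorems.BalabanUVNodesN27AtRecord12HomeOn
import Summits.QuantumFields.YangMills.Theorems.BalabanUVNodesRateReadingOfRecord12
import Summits.QuantumFields.YangMills.Theorems.BalabanUVNodesN16AtRRec12On
import Summits.QuantumFields.YangMills.Theorems.BalabanUVNodesN17AtSpineCarriers

/-!
# BalabanUVNodes ∕ N27 = binder B5 AT THE RECORD, XXIX — N27 AT THE RATE READING OF RECORD, EDITION 1
# `YMDAG.UVSplit.readingOfRecord₁₂ w1 ℓ₃ ne2 ne1` (dag-n22-e, `…RateReadingOfRecord12`): the two Stage-12 knits of record (XXVII `spine_rec12C_of_homes₁₂` at the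
# canonical homes, XXVIII `spine_rec12COn_of_homes₁₂On` at the regime-restricted homes) INSTANTIATED at the children's NAMED rate reading, the N17 slot
# ELIMINATED by name (dag-n17-a `YMDAG.N17.s_N17_of_D4_N18`: NE4 ⟸ (D4) read-out ∧ NE5 at any rate record), and every remaining rate slot UNFOLDED through
# dag-n22-e's dictionary into its sentence about NAMED objects — the kernel-checked field-by-field table of K3′'s rate side at the reading of record
# (cell `pub-ymgap`, HUMAN RULING D-0062 Track A, R134 seat `pub-ymgap-dag-n27-c` (s2) gen 4; `--supports` the K3′ item `SpineGivenEndpointR12` stmt-QuantumFields-19908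
# `--as helper`; COUNT-NEUTRAL; `N`-generic, regime-generic, NO Theses import, restate-immune)

WHY.  The K3′ composers of this package are PARAMETRIC in the rate reading `𝔯 : RateReading₁₂ N`; the children meanwhile produce their Stage-12 faces at ONE named reading —
dag-n22-e's edition 1 `readingOfRecord₁₂ w1 ℓ₃ ne2 ne1` (node U3's objects := node00-def-W1's `(w1 F θ).u3Objects θ.γ`, N16's layer := node00-def-RR-1's constant layer of record
`ne3ConstLayerOfRecord₁₁ F N (ℓ₃ F)`, N15's `ne2` and NODE O's dressed tower `ne1` residual): dag-n16-e `…N16AtRRec12On` §6 («dag-n27-c's binder `h16` AT THE NAMED READING»),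
dag-n18-d `…N18AtReadingOfRecord12(Levels)` (`s_N18_readingOfRecord₁₂_ofRecord_of_envelope_bound238`, edition 2 = `w1 := W1.ReadingData.ofRecord …`), dag-n22-c
`…N22W1StripN18Edge` (`s_N22_readingOfRecord₁₂_of_s_N18_stripBound`), dag-n22-e module 7 `…N22EdgeAtW1Reading12` (`s_N22_rRec₁₂On_w1Assignment_of_s_N18_stripBound`, `s_N22_readingOfRecord₁₂_of_s_N18_analytic`).  This module is the
JUNCTION OF RECORD at that
reading: what B5 at the Stage-12 record costs there, slot by slot, in sentences about named objects.

FIELD-BY-FIELD TABLE (rate side at `readingOfRecord₁₂ w1 ℓ₃ ne2 ne1`; canonical home reads at the datum key's parameter `h.params`, regime home at the tuple `θ` itself):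
* N14 · NE1′ — `N14At (ne1 F θ g₀ os)` on the RESIDUAL dressed tower (no producer; NODE O's object).
* N15 · NE2 — `N15At (ne2OfRecord₁₁ (ne2 F θ g₀ os k))` on the RESIDUAL paired layers (dag-n15-d∕e `s_N15_rRec₁₂_of_layers` at any reading).
* N16 · NE3 — `N16At (ne3OfRecord₁₁ F (ne3ConstLayerOfRecord₁₁ F N (ℓ₃ F)))`, ONE sentence per (guarded) family; from `InEndRegime ∧ LeafSlot` there (dag-n16-e, §1∕§2 `_of_leafSlot`).
* N17 · NE4 — ELIMINATED: `YMDAG.N17.s_N17_of_D4_N18` (dag-n17-a (W2) closer) at the home, so the slot is (D4) below + N18.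
* N18 · NE5 — `N18At (u3OfRecord₁₂ θ ((w1 F θ).u3Objects θ.γ) k)` (`g₀`, `os` IDLE); producer dag-n18-d at edition 2 from the (2.38) envelope data of THE END.
* N22 · NE9 — `N22At (u3OfRecord₁₂ θ ((w1 F θ).u3Objects θ.γ) k)` (`g₀`, `os` IDLE); producers dag-n22-c (⟸ N18 + pairing coherence + numerals + the (2.26) strip analyticity) and
  dag-n22-e module 7 (⟸ N18 + pairing coherence + the analytic sup-letter (A) + numerals, both homes).
* (D4) — `ReadOutAt D (u3OfRecord₁₂ θ ((w1 F θ).u3Objects θ.γ) k)`: the β-read-out binders linking node U3's letters to the datum's β-function (displayed; no producer;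
  at the record it reads the Stage-10 datum, dag-n17-a `readOutAt_datumOfRecord₁₂_iff_stage10`).
* `S_R00x` — not asked (XXVIII) ∕ by name (XXVII `s_R00x_rRec₁₂`).
Spine side (`cr : SpineReading₁₂ N`; N20 `RelWeightBound`, N21 `ShellWeightBound`, the keyed extraction clause, the same-tuple N19′ `NE7.Core` edge) stays PARAMETRIC: no spine
reading of record exists (dag-n20-e LOCATED (F1)–(F4)); on the singleton reading the N19′ edge IS N19's `MatchingModConstants` (dag-n27-a `coreEdge_singleton_iff_matchingModConstants`,
dag-n23-b `T4MatchingDegenerate`), so nothing on that side is junk-dischargeable.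

WHAT THIS MODULE PROVES ([bookkeeping], every theorem ONE application of a named theorem with the dictionary's `Iff`s).
* §1 CANONICAL HOME `RRec₁₂ (readingOfRecord₁₂ w1 ℓ₃ ne2 ne1)` ⇒ `Spine ₁₂C`: `spine_rec12C_at_readingOfRecord₁₂` (stub form, five rate stubs + (D4)) ·
  `spine_rec12C_at_readingOfRecord₁₂_unfolded` (dictionary form, dag-n22-e `s_N1x_readingOfRecord₁₂_iff`) · `spine_rec12C_at_readingOfRecord₁₂_of_leafSlot` (N16's sentence from
  `InEndRegime ∧ LeafSlot`, dag-n16-e `s_N16_rRec₁₂_ofRecord_of_leafSlot`).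
* §2 REGIME HOME `RRec₁₂On (readingOfRecord₁₂ w1 ℓ₃ ne2 ne1) Rg` (any regime `Rg`) ⇒ `Spine` at node00-def-RR-2's regime record class `IsRecordOfRecord₁₂COn F N Rg`:
  `spine_rec12COn_at_readingOfRecord₁₂` (stub form) · `spine_rec12COn_at_readingOfRecord₁₂_unfolded` (θ-form sentences read AT θ, dag-n22-e `s_N1x_rRec₁₂On_iff` + the reading's
  `rfl` component faces) · `spine_rec12COn_at_readingOfRecord₁₂_of_leafSlot` (dag-n16-e `s_N16_rRec₁₂On_readingOfRecord₁₂_of_leafSlot`) · `spine_rec12CN_at_readingOfRecord₁₂_unfolded`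
  (`Rg := Node00.unityNondeg₁₂ N` — the CN class, = THE ITEM at `N = 2` by XXVI `spineGivenEndpointR12_iff_spine_rec12CN`).

HONEST FRAMING.  COUNT-NEUTRAL kernel bookkeeping BY NAME at a COMPOSITE node; every node estimate (NE1′, NE2, NE3's `InEndRegime`∕`LeafSlot`, NE5, NE9, (D4), NE7b, NE7c, the
extraction clause, NE7's core edge) is a DISPLAYED hypothesis; the reading's W1 towers, `ne2`, `ne1` are residual DATA inside named containers (INHABITATION IS NOT CONTENT); no
inhabitant of any record class is claimed (K0′ `Record12Inhabited`, stmt-QuantumFields-19902, open); nothing of Bałaban's asserted or instantiated; NE1′–NE9 ∕ NE7 ∕ NE7b ∕ NE7c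
are NOT PRINTED for d = 4 and NOT PROVED; N27 NOT discharged, K3′ NOT claimed; counts UNMOVED (typed 28∕28 · discharged 5∕27, A 5∕28); one finite four-torus programme at fixed
`ε` — NOT ℝ⁴, NOT infinite volume, NOT OS, NOT a mass gap, NOT Clay.  No decl below carries a cite tag.
-/

namespace Summit.QuantumFields.YangMills.Theorems.BalabanUVNodesN27SpineRecord

open Literature.MathematicalPhysics.QuantumFieldTheory.Balaban1983to89
open Literature.MathematicalPhysics.QuantumFieldTheory.Balaban1983to89.T4Continuum
open T4ContinuumYM4Torus (ForSmallCouplings)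
open Summit.QuantumFields.BalabanUV.T4Continuum.Spine
open YMDAG.UVSplit
open Node00 (Stage12Params datumOfRecord₁₂ IsRecordOfRecord₁₂C IsDatumOfRecord₁₂C NE3Letters₁₁ NE2Objects₁₁ ne3ConstLayerOfRecord₁₁)
open Summit.QuantumFields.YangMills.BalabanUVNodes.N16Regime (InEndRegime)
open Summit.QuantumFields.YangMills.BalabanUVNodes.N16LeafSlot (LeafSlot)
open Summit.QuantumFields.YangMills.BalabanUVNodes.N16AtRRec12OfRecord (s_N16_rRec₁₂_ofRecord_of_leafSlot)
open Summit.QuantumFields.YangMills.BalabanUVNodes.N16AtRRec12On (s_N16_rRec₁₂On_readingOfRecord₁₂_iff s_N16_rRec₁₂On_readingOfRecord₁₂_of_leafSlot)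

variable {N : ℕ} [NeZero N] (cr : SpineReading₁₂ N)
  (w1 : (F : T4Family) → (θ : Stage12Params F N) → Node00.W1.ReadingData F (Node00.MatA N) θ.τ9.M) (ℓ₃ : T4Family → NE3Letters₁₁)
  (ne2 : (F : T4Family) → Stage12Params F N → (ℕ → ℝ) → List (ULoop F) → ℕ → NE2Objects₁₁)
  (ne1 : (F : T4Family) → Stage12Params F N → (ℕ → ℝ) → List (ULoop F) → NE1pCarriers)

/-! ## §1 The canonical home at the reading of record -/

section Canonical

/-- **N27 = B5 AT THE STAGE-12 RECORD FROM THE STUBS AT THE CANONICAL HOME OF THE READING OF RECORD, N17 ELIMINATED** (XXVII `spine_rec12C_of_homes₁₂` at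
`𝔯 := readingOfRecord₁₂ w1 ℓ₃ ne2 ne1`, `h17 := YMDAG.N17.s_N17_of_D4_N18 _ hD4 h18`): the five rate stubs N14 · N15 · N16 · N18 · N22 and the (D4) read-out stub at
`RRec₁₂ (readingOfRecord₁₂ …)`, the three K5 stubs at `SRec₁₂ cr` and the home-keyed N19′ edge ⇒ `Spine ₁₂C`.  Every hypothesis 0∕1 today. [bookkeeping] -/
theorem spine_rec12C_at_readingOfRecord₁₂
    (h14 : S_N14 (RRec₁₂ (readingOfRecord₁₂ w1 ℓ₃ ne2 ne1))) (h15 : S_N15 (RRec₁₂ (readingOfRecord₁₂ w1 ℓ₃ ne2 ne1)))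
    (h16 : S_N16 (RRec₁₂ (readingOfRecord₁₂ w1 ℓ₃ ne2 ne1))) (h18 : S_N18 (RRec₁₂ (readingOfRecord₁₂ w1 ℓ₃ ne2 ne1)))
    (h22 : S_N22 (RRec₁₂ (readingOfRecord₁₂ w1 ℓ₃ ne2 ne1))) (hD4 : S_D4 (RRec₁₂ (readingOfRecord₁₂ w1 ℓ₃ ne2 ne1)))
    (hx' : S_N27x (fun F D w => IsRecordOfRecord₁₂C F N D w) (SRec₁₂ cr)) (h20 : S_N20 (SRec₁₂ cr)) (h21 : S_N21 (SRec₁₂ cr))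
    (h19 : ∀ (F : T4Family) (θ : Stage12Params F N) (hP : θ.Provisos₁₂ F N), θ.Admissible F N → ∀ (g₀ : ℕ → ℝ) (os : List (ULoop F))
      (h : IsDatumOfRecord₁₂C F N (datumOfRecord₁₂ F N θ hP)) (k : ℕ),
      RatesAt (datumOfRecord₁₂ F N θ hP) (rateCarriersOfRecord₁₂ (readingOfRecord₁₂ w1 ℓ₃ ne2 ne1) F h.params h.provisos g₀ os k) → letI := (cr F θ hP g₀ os).dec
        ∃ δ : ℕ → ℝ, NE7.Core (cr F θ hP g₀ os).l₀ (cr F θ hP g₀ os).vol (cr F θ hP g₀ os).T (cr F θ hP g₀ os).Bad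
          (fun K t τ => (cr F θ hP g₀ os).A K t τ - (cr F θ hP g₀ os).shA K t τ) (fun K t τ => (cr F θ hP g₀ os).B K t τ - (cr F θ hP g₀ os).shB K t τ) δ ∧
          Summable δ) :
    Spine (N := N) fun F D w => IsRecordOfRecord₁₂C F N D w :=
  spine_rec12C_of_homes₁₂ cr _ h14 h15 h16 (YMDAG.N17.s_N17_of_D4_N18 _ hD4 h18) h18 h22 hx' h20 h21 h19

/-- **THE SAME WITH EVERY RATE SLOT UNFOLDED INTO ITS SENTENCE ABOUT NAMED OBJECTS** (dag-n22-e's dictionary `s_N14∕s_N15∕s_N16∕s_N18∕s_N22∕s_D4_readingOfRecord₁₂_iff`, read at the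
datum key's canonical parameter `h.params`): NE1′ on the residual dressed tower `ne1`, NE2 on the residual layers `ne2`, NE3 at node00-def-RR-1's constant layer of record ONCE PER
FAMILY, NE5 ∕ NE9 ∕ (D4) on node00-def-W1's objects `(w1 F h.params).u3Objects h.params.γ` at every run length — `g₀`, `os` IDLE in the last four. [bookkeeping] -/
theorem spine_rec12C_at_readingOfRecord₁₂_unfolded
    (h14 : ∀ (F : T4Family) (D : Datum F N) (h : IsDatumOfRecord₁₂C F N D) (g₀ : ℕ → ℝ) (os : List (ULoop F)), N14At (ne1 F h.params g₀ os))
    (h15 : ∀ (F : T4Family) (D : Datum F N) (h : IsDatumOfRecord₁₂C F N D) (g₀ : ℕ → ℝ) (os : List (ULoop F)) (k : ℕ),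
      N15At (ne2OfRecord₁₁ (ne2 F h.params g₀ os k)))
    (h16 : ∀ (F : T4Family), (∃ D : Datum F N, IsDatumOfRecord₁₂C F N D) → N16At (ne3OfRecord₁₁ F (ne3ConstLayerOfRecord₁₁ F N (ℓ₃ F))))
    (h18 : ∀ (F : T4Family) (D : Datum F N) (h : IsDatumOfRecord₁₂C F N D) (k : ℕ), N18At (u3OfRecord₁₂ h.params ((w1 F h.params).u3Objects h.params.γ) k))
    (h22 : ∀ (F : T4Family) (D : Datum F N) (h : IsDatumOfRecord₁₂C F N D) (k : ℕ), N22At (u3OfRecord₁₂ h.params ((w1 F h.params).u3Objects h.params.γ) k))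
    (hD4 : ∀ (F : T4Family) (D : Datum F N) (h : IsDatumOfRecord₁₂C F N D) (k : ℕ), ReadOutAt D (u3OfRecord₁₂ h.params ((w1 F h.params).u3Objects h.params.γ) k))
    (hx' : S_N27x (fun F D w => IsRecordOfRecord₁₂C F N D w) (SRec₁₂ cr)) (h20 : S_N20 (SRec₁₂ cr)) (h21 : S_N21 (SRec₁₂ cr))
    (h19 : ∀ (F : T4Family) (θ : Stage12Params F N) (hP : θ.Provisos₁₂ F N), θ.Admissible F N → ∀ (g₀ : ℕ → ℝ) (os : List (ULoop F))
      (h : IsDatumOfRecord₁₂C F N (datumOfRecord₁₂ F N θ hP)) (k : ℕ),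
      RatesAt (datumOfRecord₁₂ F N θ hP) (rateCarriersOfRecord₁₂ (readingOfRecord₁₂ w1 ℓ₃ ne2 ne1) F h.params h.provisos g₀ os k) → letI := (cr F θ hP g₀ os).dec
        ∃ δ : ℕ → ℝ, NE7.Core (cr F θ hP g₀ os).l₀ (cr F θ hP g₀ os).vol (cr F θ hP g₀ os).T (cr F θ hP g₀ os).Bad
          (fun K t τ => (cr F θ hP g₀ os).A K t τ - (cr F θ hP g₀ os).shA K t τ) (fun K t τ => (cr F θ hP g₀ os).B K t τ - (cr F θ hP g₀ os).shB K t τ) δ ∧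
          Summable δ) :
    Spine (N := N) fun F D w => IsRecordOfRecord₁₂C F N D w :=
  spine_rec12C_at_readingOfRecord₁₂ cr w1 ℓ₃ ne2 ne1 ((s_N14_readingOfRecord₁₂_iff w1 ℓ₃ ne2 ne1).mpr h14)
    ((s_N15_readingOfRecord₁₂_iff w1 ℓ₃ ne2 ne1).mpr h15) ((s_N16_readingOfRecord₁₂_iff w1 ℓ₃ ne2 ne1).mpr h16)
    ((s_N18_readingOfRecord₁₂_iff w1 ℓ₃ ne2 ne1).mpr h18) ((s_N22_readingOfRecord₁₂_iff w1 ℓ₃ ne2 ne1).mpr h22)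
    ((s_D4_readingOfRecord₁₂_iff w1 ℓ₃ ne2 ne1).mpr hD4) hx' h20 h21 h19

/-- **… WITH N16's SENTENCE FROM ITS CONTENT FORM** `InEndRegime ∧ LeafSlot` at node00-def-RR-1's layer of every family carrying a Stage-12 datum of record (dag-n16-e
`s_N16_rRec₁₂_ofRecord_of_leafSlot`, pin `rfl` at the reading of record). [bookkeeping] -/
theorem spine_rec12C_at_readingOfRecord₁₂_of_leafSlot
    (h14 : ∀ (F : T4Family) (D : Datum F N) (h : IsDatumOfRecord₁₂C F N D) (g₀ : ℕ → ℝ) (os : List (ULoop F)), N14At (ne1 F h.params g₀ os))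
    (h15 : ∀ (F : T4Family) (D : Datum F N) (h : IsDatumOfRecord₁₂C F N D) (g₀ : ℕ → ℝ) (os : List (ULoop F)) (k : ℕ),
      N15At (ne2OfRecord₁₁ (ne2 F h.params g₀ os k)))
    (h16 : ∀ (F : T4Family), (∃ D : Datum F N, IsDatumOfRecord₁₂C F N D) →
      InEndRegime (ne3OfRecord₁₁ F (ne3ConstLayerOfRecord₁₁ F N (ℓ₃ F))) ∧ LeafSlot (ne3OfRecord₁₁ F (ne3ConstLayerOfRecord₁₁ F N (ℓ₃ F))))
    (h18 : ∀ (F : T4Family) (D : Datum F N) (h : IsDatumOfRecord₁₂C F N D) (k : ℕ), N18At (u3OfRecord₁₂ h.params ((w1 F h.params).u3Objects h.params.γ) k))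
    (h22 : ∀ (F : T4Family) (D : Datum F N) (h : IsDatumOfRecord₁₂C F N D) (k : ℕ), N22At (u3OfRecord₁₂ h.params ((w1 F h.params).u3Objects h.params.γ) k))
    (hD4 : ∀ (F : T4Family) (D : Datum F N) (h : IsDatumOfRecord₁₂C F N D) (k : ℕ), ReadOutAt D (u3OfRecord₁₂ h.params ((w1 F h.params).u3Objects h.params.γ) k))
    (hx' : S_N27x (fun F D w => IsRecordOfRecord₁₂C F N D w) (SRec₁₂ cr)) (h20 : S_N20 (SRec₁₂ cr)) (h21 : S_N21 (SRec₁₂ cr))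
    (h19 : ∀ (F : T4Family) (θ : Stage12Params F N) (hP : θ.Provisos₁₂ F N), θ.Admissible F N → ∀ (g₀ : ℕ → ℝ) (os : List (ULoop F))
      (h : IsDatumOfRecord₁₂C F N (datumOfRecord₁₂ F N θ hP)) (k : ℕ),
      RatesAt (datumOfRecord₁₂ F N θ hP) (rateCarriersOfRecord₁₂ (readingOfRecord₁₂ w1 ℓ₃ ne2 ne1) F h.params h.provisos g₀ os k) → letI := (cr F θ hP g₀ os).dec
        ∃ δ : ℕ → ℝ, NE7.Core (cr F θ hP g₀ os).l₀ (cr F θ hP g₀ os).vol (cr F θ hP g₀ os).T (cr F θ hP g₀ os).Bad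
          (fun K t τ => (cr F θ hP g₀ os).A K t τ - (cr F θ hP g₀ os).shA K t τ) (fun K t τ => (cr F θ hP g₀ os).B K t τ - (cr F θ hP g₀ os).shB K t τ) δ ∧
          Summable δ) :
    Spine (N := N) fun F D w => IsRecordOfRecord₁₂C F N D w :=
  spine_rec12C_at_readingOfRecord₁₂ cr w1 ℓ₃ ne2 ne1 ((s_N14_readingOfRecord₁₂_iff w1 ℓ₃ ne2 ne1).mpr h14)
    ((s_N15_readingOfRecord₁₂_iff w1 ℓ₃ ne2 ne1).mpr h15)
    (s_N16_rRec₁₂_ofRecord_of_leafSlot (readingOfRecord₁₂ w1 ℓ₃ ne2 ne1) ℓ₃ (fun _ _ _ _ _ _ => rfl) h16)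
    ((s_N18_readingOfRecord₁₂_iff w1 ℓ₃ ne2 ne1).mpr h18) ((s_N22_readingOfRecord₁₂_iff w1 ℓ₃ ne2 ne1).mpr h22)
    ((s_D4_readingOfRecord₁₂_iff w1 ℓ₃ ne2 ne1).mpr hD4) hx' h20 h21 h19

end Canonical

/-! ## §2 The regime-restricted home at the reading of record, any regime `Rg` -/

section Regime

variable (Rg : (F : T4Family) → Stage12Params F N → Prop)

/-- **N27 = B5 AT THE REGIME RECORD CLASS FROM THE STUBS AT THE REGIME HOME OF THE READING OF RECORD, N17 ELIMINATED** (XXVIII `spine_rec12COn_of_homes₁₂On` at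
`𝔯 := readingOfRecord₁₂ w1 ℓ₃ ne2 ne1`, `h17 := YMDAG.N17.s_N17_of_D4_N18 _ hD4 h18`): the five rate stubs and (D4) at `RRec₁₂On (readingOfRecord₁₂ …) Rg`, N20 ∕ N21 at `SRec₁₂On cr Rg`,
the guarded keyed extraction clause and the same-tuple all-run-lengths N19′ edge ⇒ `Spine` at `IsRecordOfRecord₁₂COn F N Rg`.  Every hypothesis 0∕1 today. [bookkeeping] -/
theorem spine_rec12COn_at_readingOfRecord₁₂
    (h14 : S_N14 (RRec₁₂On (readingOfRecord₁₂ w1 ℓ₃ ne2 ne1) Rg)) (h15 : S_N15 (RRec₁₂On (readingOfRecord₁₂ w1 ℓ₃ ne2 ne1) Rg))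
    (h16 : S_N16 (RRec₁₂On (readingOfRecord₁₂ w1 ℓ₃ ne2 ne1) Rg)) (h18 : S_N18 (RRec₁₂On (readingOfRecord₁₂ w1 ℓ₃ ne2 ne1) Rg))
    (h22 : S_N22 (RRec₁₂On (readingOfRecord₁₂ w1 ℓ₃ ne2 ne1) Rg)) (hD4 : S_D4 (RRec₁₂On (readingOfRecord₁₂ w1 ℓ₃ ne2 ne1) Rg))
    (h20 : S_N20 (SRec₁₂On cr Rg)) (h21 : S_N21 (SRec₁₂On cr Rg))
    (hx : ∀ (F : T4Family) (θ : Stage12Params F N) (hP : θ.Provisos₁₂ F N), Rg F θ → θ.Admissible F N →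
      B16.EndStatementBPrinted (datumOfRecord₁₂ F N θ hP).C → DagBinding.EndpointExistence (datumOfRecord₁₂ F N θ hP).C.toB12 →
        ForSmallCouplings (datumOfRecord₁₂ F N θ hP) fun g₀ => ∀ os : List (ULoop F),
          0 < (cr F θ hP g₀ os).l₀ ∧ 0 < (cr F θ hP g₀ os).vol ∧
          (∀ (K : ℕ) (t : ℝ), |t| ≤ (cr F θ hP g₀ os).l₀ →
            T4GenFunBounds.schemeZ ((datumOfRecord₁₂ F N θ hP).scheme g₀) os ((cr F θ hP g₀ os).K₀ + K) t =
              ∑ τ ∈ (cr F θ hP g₀ os).T K, (cr F θ hP g₀ os).A K t τ) ∧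
          (∀ (K : ℕ) (t : ℝ), |t| ≤ (cr F θ hP g₀ os).l₀ →
            T4GenFunBounds.schemeZ ((datumOfRecord₁₂ F N θ hP).scheme g₀) os ((cr F θ hP g₀ os).K₀ + K + 1) t =
              ∑ τ ∈ (cr F θ hP g₀ os).T K, (cr F θ hP g₀ os).B K t τ))
    (h19 : ∀ (F : T4Family) (θ : Stage12Params F N) (hP : θ.Provisos₁₂ F N), Rg F θ → θ.Admissible F N → ∀ (g₀ : ℕ → ℝ) (os : List (ULoop F)),
      (∀ k : ℕ, RatesAt (datumOfRecord₁₂ F N θ hP) (rateCarriersOfRecord₁₂ (readingOfRecord₁₂ w1 ℓ₃ ne2 ne1) F θ hP g₀ os k)) → letI := (cr F θ hP g₀ os).dec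
        ∃ δ : ℕ → ℝ, NE7.Core (cr F θ hP g₀ os).l₀ (cr F θ hP g₀ os).vol (cr F θ hP g₀ os).T (cr F θ hP g₀ os).Bad
          (fun K t τ => (cr F θ hP g₀ os).A K t τ - (cr F θ hP g₀ os).shA K t τ) (fun K t τ => (cr F θ hP g₀ os).B K t τ - (cr F θ hP g₀ os).shB K t τ) δ ∧
          Summable δ) :
    Spine (N := N) fun F D w => Node00.IsRecordOfRecord₁₂COn F N Rg D w :=
  spine_rec12COn_of_homes₁₂On cr _ Rg h14 h15 h16 (YMDAG.N17.s_N17_of_D4_N18 _ hD4 h18) h18 h22 h20 h21 hx h19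

/-- **THE SAME WITH EVERY RATE SLOT UNFOLDED INTO ITS GUARDED θ-FORM SENTENCE READ AT θ** (dag-n22-e `s_N1x_rRec₁₂On_iff` at the reading of record, components by `rfl`; N16 in
dag-n16-e's once-per-guarded-family form `s_N16_rRec₁₂On_readingOfRecord₁₂_iff`): for every family, every Stage-12 tuple with provisos IN THE REGIME, admissible — NE1′ on
`ne1 F θ g₀ os`, NE2 on `ne2 F θ g₀ os k`, NE5 ∕ NE9 ∕ (D4) on `(w1 F θ).u3Objects θ.γ` at every run length (`g₀`, `os` IDLE); NE3 once per guarded family. [bookkeeping] -/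
theorem spine_rec12COn_at_readingOfRecord₁₂_unfolded
    (h14 : ∀ (F : T4Family) (θ : Stage12Params F N), θ.Provisos₁₂ F N → Rg F θ → θ.Admissible F N → ∀ (g₀ : ℕ → ℝ) (os : List (ULoop F)),
      N14At (ne1 F θ g₀ os))
    (h15 : ∀ (F : T4Family) (θ : Stage12Params F N), θ.Provisos₁₂ F N → Rg F θ → θ.Admissible F N → ∀ (g₀ : ℕ → ℝ) (os : List (ULoop F)) (k : ℕ),
      N15At (ne2OfRecord₁₁ (ne2 F θ g₀ os k)))
    (h16 : ∀ (F : T4Family), (∃ θ : Stage12Params F N, θ.Provisos₁₂ F N ∧ Rg F θ ∧ θ.Admissible F N) →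
      N16At (ne3OfRecord₁₁ F (ne3ConstLayerOfRecord₁₁ F N (ℓ₃ F))))
    (h18 : ∀ (F : T4Family) (θ : Stage12Params F N), θ.Provisos₁₂ F N → Rg F θ → θ.Admissible F N → ∀ k : ℕ,
      N18At (u3OfRecord₁₂ θ ((w1 F θ).u3Objects θ.γ) k))
    (h22 : ∀ (F : T4Family) (θ : Stage12Params F N), θ.Provisos₁₂ F N → Rg F θ → θ.Admissible F N → ∀ k : ℕ,
      N22At (u3OfRecord₁₂ θ ((w1 F θ).u3Objects θ.γ) k))
    (hD4 : ∀ (F : T4Family) (θ : Stage12Params F N) (hP : θ.Provisos₁₂ F N), Rg F θ → θ.Admissible F N → ∀ k : ℕ,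
      ReadOutAt (datumOfRecord₁₂ F N θ hP) (u3OfRecord₁₂ θ ((w1 F θ).u3Objects θ.γ) k))
    (h20 : S_N20 (SRec₁₂On cr Rg)) (h21 : S_N21 (SRec₁₂On cr Rg))
    (hx : ∀ (F : T4Family) (θ : Stage12Params F N) (hP : θ.Provisos₁₂ F N), Rg F θ → θ.Admissible F N →
      B16.EndStatementBPrinted (datumOfRecord₁₂ F N θ hP).C → DagBinding.EndpointExistence (datumOfRecord₁₂ F N θ hP).C.toB12 →
        ForSmallCouplings (datumOfRecord₁₂ F N θ hP) fun g₀ => ∀ os : List (ULoop F),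
          0 < (cr F θ hP g₀ os).l₀ ∧ 0 < (cr F θ hP g₀ os).vol ∧
          (∀ (K : ℕ) (t : ℝ), |t| ≤ (cr F θ hP g₀ os).l₀ →
            T4GenFunBounds.schemeZ ((datumOfRecord₁₂ F N θ hP).scheme g₀) os ((cr F θ hP g₀ os).K₀ + K) t =
              ∑ τ ∈ (cr F θ hP g₀ os).T K, (cr F θ hP g₀ os).A K t τ) ∧
          (∀ (K : ℕ) (t : ℝ), |t| ≤ (cr F θ hP g₀ os).l₀ →
            T4GenFunBounds.schemeZ ((datumOfRecord₁₂ F N θ hP).scheme g₀) os ((cr F θ hP g₀ os).K₀ + K + 1) t =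
              ∑ τ ∈ (cr F θ hP g₀ os).T K, (cr F θ hP g₀ os).B K t τ))
    (h19 : ∀ (F : T4Family) (θ : Stage12Params F N) (hP : θ.Provisos₁₂ F N), Rg F θ → θ.Admissible F N → ∀ (g₀ : ℕ → ℝ) (os : List (ULoop F)),
      (∀ k : ℕ, RatesAt (datumOfRecord₁₂ F N θ hP) (rateCarriersOfRecord₁₂ (readingOfRecord₁₂ w1 ℓ₃ ne2 ne1) F θ hP g₀ os k)) → letI := (cr F θ hP g₀ os).dec
        ∃ δ : ℕ → ℝ, NE7.Core (cr F θ hP g₀ os).l₀ (cr F θ hP g₀ os).vol (cr F θ hP g₀ os).T (cr F θ hP g₀ os).Bad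
          (fun K t τ => (cr F θ hP g₀ os).A K t τ - (cr F θ hP g₀ os).shA K t τ) (fun K t τ => (cr F θ hP g₀ os).B K t τ - (cr F θ hP g₀ os).shB K t τ) δ ∧
          Summable δ) :
    Spine (N := N) fun F D w => Node00.IsRecordOfRecord₁₂COn F N Rg D w :=
  spine_rec12COn_at_readingOfRecord₁₂ cr w1 ℓ₃ ne2 ne1 Rg
    ((s_N14_rRec₁₂On_iff _ Rg).mpr fun F θ hP hRg hθ g₀ os => h14 F θ hP hRg hθ g₀ os)
    ((s_N15_rRec₁₂On_iff _ Rg).mpr fun F θ hP hRg hθ g₀ os k => h15 F θ hP hRg hθ g₀ os k)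
    ((s_N16_rRec₁₂On_readingOfRecord₁₂_iff Rg w1 ℓ₃ ne2 ne1).mpr h16)
    ((s_N18_rRec₁₂On_iff _ Rg).mpr fun F θ hP hRg hθ _ _ k => h18 F θ hP hRg hθ k)
    ((s_N22_rRec₁₂On_iff _ Rg).mpr fun F θ hP hRg hθ _ _ k => h22 F θ hP hRg hθ k)
    ((s_D4_rRec₁₂On_iff _ Rg).mpr fun F θ hP hRg hθ _ _ k => hD4 F θ hP hRg hθ k) h20 h21 hx h19

/-- **… WITH N16's SENTENCE FROM ITS CONTENT FORM** `InEndRegime ∧ LeafSlot` at node00-def-RR-1's layer of every guarded family (dag-n16-e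
`s_N16_rRec₁₂On_readingOfRecord₁₂_of_leafSlot` — «dag-n27-c's binder `h16` AT THE NAMED READING», here consumed). [bookkeeping] -/
theorem spine_rec12COn_at_readingOfRecord₁₂_of_leafSlot
    (h14 : ∀ (F : T4Family) (θ : Stage12Params F N), θ.Provisos₁₂ F N → Rg F θ → θ.Admissible F N → ∀ (g₀ : ℕ → ℝ) (os : List (ULoop F)),
      N14At (ne1 F θ g₀ os))
    (h15 : ∀ (F : T4Family) (θ : Stage12Params F N), θ.Provisos₁₂ F N → Rg F θ → θ.Admissible F N → ∀ (g₀ : ℕ → ℝ) (os : List (ULoop F)) (k : ℕ),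
      N15At (ne2OfRecord₁₁ (ne2 F θ g₀ os k)))
    (h16 : ∀ (F : T4Family), (∃ θ : Stage12Params F N, θ.Provisos₁₂ F N ∧ Rg F θ ∧ θ.Admissible F N) →
      InEndRegime (ne3OfRecord₁₁ F (ne3ConstLayerOfRecord₁₁ F N (ℓ₃ F))) ∧ LeafSlot (ne3OfRecord₁₁ F (ne3ConstLayerOfRecord₁₁ F N (ℓ₃ F))))
    (h18 : ∀ (F : T4Family) (θ : Stage12Params F N), θ.Provisos₁₂ F N → Rg F θ → θ.Admissible F N → ∀ k : ℕ,
      N18At (u3OfRecord₁₂ θ ((w1 F θ).u3Objects θ.γ) k))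
    (h22 : ∀ (F : T4Family) (θ : Stage12Params F N), θ.Provisos₁₂ F N → Rg F θ → θ.Admissible F N → ∀ k : ℕ,
      N22At (u3OfRecord₁₂ θ ((w1 F θ).u3Objects θ.γ) k))
    (hD4 : ∀ (F : T4Family) (θ : Stage12Params F N) (hP : θ.Provisos₁₂ F N), Rg F θ → θ.Admissible F N → ∀ k : ℕ,
      ReadOutAt (datumOfRecord₁₂ F N θ hP) (u3OfRecord₁₂ θ ((w1 F θ).u3Objects θ.γ) k))
    (h20 : S_N20 (SRec₁₂On cr Rg)) (h21 : S_N21 (SRec₁₂On cr Rg))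
    (hx : ∀ (F : T4Family) (θ : Stage12Params F N) (hP : θ.Provisos₁₂ F N), Rg F θ → θ.Admissible F N →
      B16.EndStatementBPrinted (datumOfRecord₁₂ F N θ hP).C → DagBinding.EndpointExistence (datumOfRecord₁₂ F N θ hP).C.toB12 →
        ForSmallCouplings (datumOfRecord₁₂ F N θ hP) fun g₀ => ∀ os : List (ULoop F),
          0 < (cr F θ hP g₀ os).l₀ ∧ 0 < (cr F θ hP g₀ os).vol ∧
          (∀ (K : ℕ) (t : ℝ), |t| ≤ (cr F θ hP g₀ os).l₀ →
            T4GenFunBounds.schemeZ ((datumOfRecord₁₂ F N θ hP).scheme g₀) os ((cr F θ hP g₀ os).K₀ + K) t =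
              ∑ τ ∈ (cr F θ hP g₀ os).T K, (cr F θ hP g₀ os).A K t τ) ∧
          (∀ (K : ℕ) (t : ℝ), |t| ≤ (cr F θ hP g₀ os).l₀ →
            T4GenFunBounds.schemeZ ((datumOfRecord₁₂ F N θ hP).scheme g₀) os ((cr F θ hP g₀ os).K₀ + K + 1) t =
              ∑ τ ∈ (cr F θ hP g₀ os).T K, (cr F θ hP g₀ os).B K t τ))
    (h19 : ∀ (F : T4Family) (θ : Stage12Params F N) (hP : θ.Provisos₁₂ F N), Rg F θ → θ.Admissible F N → ∀ (g₀ : ℕ → ℝ) (os : List (ULoop F)),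
      (∀ k : ℕ, RatesAt (datumOfRecord₁₂ F N θ hP) (rateCarriersOfRecord₁₂ (readingOfRecord₁₂ w1 ℓ₃ ne2 ne1) F θ hP g₀ os k)) → letI := (cr F θ hP g₀ os).dec
        ∃ δ : ℕ → ℝ, NE7.Core (cr F θ hP g₀ os).l₀ (cr F θ hP g₀ os).vol (cr F θ hP g₀ os).T (cr F θ hP g₀ os).Bad
          (fun K t τ => (cr F θ hP g₀ os).A K t τ - (cr F θ hP g₀ os).shA K t τ) (fun K t τ => (cr F θ hP g₀ os).B K t τ - (cr F θ hP g₀ os).shB K t τ) δ ∧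
          Summable δ) :
    Spine (N := N) fun F D w => Node00.IsRecordOfRecord₁₂COn F N Rg D w :=
  spine_rec12COn_at_readingOfRecord₁₂ cr w1 ℓ₃ ne2 ne1 Rg
    ((s_N14_rRec₁₂On_iff _ Rg).mpr fun F θ hP hRg hθ g₀ os => h14 F θ hP hRg hθ g₀ os)
    ((s_N15_rRec₁₂On_iff _ Rg).mpr fun F θ hP hRg hθ g₀ os k => h15 F θ hP hRg hθ g₀ os k)
    (s_N16_rRec₁₂On_readingOfRecord₁₂_of_leafSlot Rg w1 ℓ₃ ne2 ne1 h16)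
    ((s_N18_rRec₁₂On_iff _ Rg).mpr fun F θ hP hRg hθ _ _ k => h18 F θ hP hRg hθ k)
    ((s_N22_rRec₁₂On_iff _ Rg).mpr fun F θ hP hRg hθ _ _ k => h22 F θ hP hRg hθ k)
    ((s_D4_rRec₁₂On_iff _ Rg).mpr fun F θ hP hRg hθ _ _ k => hD4 F θ hP hRg hθ k) h20 h21 hx h19

end Regime

end Summit.QuantumFields.YangMills.Theorems.BalabanUVNodesN27SpineRecord
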